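import Literature.NumberTheory.EllipticCurves.ModularCurve
import Literature.NumberTheory.EllipticCurves.RealPeriodProofs
import Literature.NumberTheory.EllipticCurves.ModularFormsGamma0Genus
import Literature.NumberTheory.EllipticCurves.ModularCurveManinConstantProofs
import Literature.NumberTheory.EllipticCurves.PAdicLFunctionProofs
import HarnessLib

/-!
# Discharge of `ModularParametrizationData.realPeriodRat_dvd` (the period relation
# `m · Ω(W) = |c| · Ω⁺_f`)

D-0014 keeps `Literature/` sorry-free by stating cited results as named facts `def X : Prop`.
This sibling file of `Literature/NumberTheory/EllipticCurves/ModularCurve.lean` proves the named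
fact `Literature.NumberTheory.EllipticCurves.ModularForms.ModularParametrizationData.realPeriodRat_dvd`
(Edixhoven 1991, §1; Cremona 1997, §2.8 and §2.10): for a modular parametrisation datum `D` of an
elliptic curve `W/ℚ` with Manin constant `c` (`c Λ_f ⊆ Λ_E`), there is a positive integer `m` with
`m · Ω(W) = |c| · Ω⁺_f`, where `Ω(W) = W.realPeriodRat = 2∫_{ψ>0} dx/√ψ` is the real period of the
model (item G06) and `Ω⁺_f = plusPeriod D.f` is the real period of the newform (`re Λ_f = ℤ · Ω⁺_f/2`,
item C9).

Architecture (the argument recorded in the docstring of the fact; Cremona §2.8, p. 26: "`Ω(f)/Ω₀(f)`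
is the number of components of the real locus … in each case `Ω(f)` is twice the least real part of
a period"):

1. `Λ_E = D.L.lattice` has the real invariants `g₂ = c₄/12`, `g₃ = c₆/216`, so it is a real lattice
   (`PeriodPair.isReal_of_g₂_g₃_real` with `PeriodPair.uniformization_unique_holds`).
2. `Ω(W) = n · Ω₀(Λ_E)` with `n = 2` if `Δ > 0` and `n = 1` if `Δ < 0`
   (`WeierstrassCurve.exists_periodPair_realPeriod_eq_holds`, transported to `D.L` by uniqueness).
3. **Shape of a real lattice** (Lawden §6.15–§6.16; Silverman ATAEC V.2): always
   `2 re z = z + z̄ ∈ Λ ∩ ℝ = ℤΩ₀`, so `re Λ ⊆ ℤ(Ω₀/2)`; and if `g₂³ − 27g₃² > 0` the lattice is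
   rectangular, `re Λ ⊆ ℤΩ₀` (`PeriodPair.IsReal.exists_re_eq_int_mul_of_discr_pos`, proved here from
   `Λ ⊆ ℤ(Ω₀/2) ⊕ iℤ(Ω₀'/2)`, `Ω₀/2 ∉ Λ`, and: `Ω₀/2 + iΩ₀'/2 ∈ Λ` (rhombic) forces `e₁` to be the
   only real root of `4x³ − g₂x − g₃`, contradicting `disc > 0` — the argument of
   `PeriodPair.IsReal.integral_inv_sqrt_cubic_of_discr_pos_eq`). Hence `re Λ_E ⊆ ℤ · Ω(W)/2` in both
   cases (`(c₄/12)³ − 27(c₆/216)² = Δ`).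
4. `Ω⁺_f > 0` (`IsNewform0.plusPeriod_pos_holds`, Eichler–Shimura via the dimension formula, for the
   rational newform `D.f`), so `re Λ_f = ℤ · Ω⁺_f/2` and some `z ∈ Λ_f` has `re z = Ω⁺_f/2`.
5. `c z ∈ Λ_E` gives `c Ω⁺_f/2 = k Ω(W)/2`, `k ∈ ℤ`, `k ≠ 0` as `c ≠ 0`
   (`maninConstant_ne_zero_holds`) and `Ω⁺_f > 0`; `m = |k|`.

The `PeriodPair` lemmas are a deliberate dot-notation extension of Mathlib's `PeriodPair`
namespace (as in `RealLatticePeriod*.lean`).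

## References

* B. Edixhoven, *On the Manin constants of modular elliptic curves*, in *Arithmetic algebraic
  geometry (Texel, 1989)*, Progr. Math. 89, Birkhäuser (1991), 25–39, §1. [EdixhovenManin1991]
* J. E. Cremona, *Algorithms for modular elliptic curves*, 2nd ed., CUP 1997, §2.8 (p. 26), §2.10.
  [CremonaAlgorithms1997]
* D. F. Lawden, *Elliptic Functions and Applications*, Springer 1989, §§6.15–6.16. [Lawden1989]
* J. H. Silverman, *Advanced Topics in the Arithmetic of Elliptic Curves*, GTM 151, V.2
  (Thm. 2.3, Cor. 2.3.1).
-/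

noncomputable section

open scoped ComplexConjugate
open Complex

/-! ### Real lattices: `re Λ ⊆ ℤ(Ω₀/2)`, and `re Λ ⊆ ℤΩ₀` in the rectangular case -/

namespace PeriodPair

variable {L : PeriodPair}

/-- For a real lattice `Λ` with least positive real period `Ω₀`: `re z ∈ ℤ · (Ω₀/2)` for every
`z ∈ Λ`, since `2 re z = z + z̄ ∈ Λ ∩ ℝ = ℤΩ₀` (Cremona §2.8, p. 26; Lawden §6.15). [folklore] -/
theorem IsReal.exists_re_eq_int_mul_half (h : L.IsReal) {z : ℂ} (hz : z ∈ L.lattice) :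
    ∃ k : ℤ, z.re = k * (L.minRealPeriod / 2) := by
  have h2 : ((2 * z.re : ℝ) : ℂ) ∈ L.lattice := by
    rw [← Complex.add_conj]
    exact add_mem hz (h z hz)
  obtain ⟨k, hk⟩ := h.exists_eq_int_mul h2
  exact ⟨k, by linarith⟩

/-- For a real lattice `Λ`: `im z ∈ ℤ · (Ω₀'/2)` for every `z ∈ Λ`, where `Ω₀'` is the least positive
real period of the (real) rotated lattice `iΛ`, since `z − z̄ = 2i im z ∈ Λ ∩ iℝ = iℤΩ₀'`
(Lawden §6.15). [folklore] -/
theorem IsReal.exists_im_eq_int_mul_half (h : L.IsReal) {z : ℂ} (hz : z ∈ L.lattice) :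
    ∃ k : ℤ, z.im = k * ((L.mulLeft I I_ne_zero).minRealPeriod / 2) := by
  have h1 : I * (z - conj z) ∈ (L.mulLeft I I_ne_zero).lattice :=
    mul_mem_mulLeft_lattice.mpr (sub_mem hz (h z hz))
  have h2 : ((-(2 * z.im) : ℝ) : ℂ) ∈ (L.mulLeft I I_ne_zero).lattice := by
    have e : I * (z - conj z) = ((-(2 * z.im) : ℝ) : ℂ) := by
      rw [Complex.sub_conj]
      push_cast
      linear_combination (2 * (z.im : ℂ)) * Complex.I_sq
    rw [← e]
    exact h1
  obtain ⟨k, hk⟩ := h.mulLeft_I.exists_eq_int_mul h2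
  exact ⟨-k, by push_cast; linarith⟩

/-- `Ω₀/2 ∉ Λ` for a real lattice (minimality of `Ω₀`). [folklore] -/
theorem IsReal.half_minRealPeriod_notMem (h : L.IsReal) :
    ((L.minRealPeriod / 2 : ℝ) : ℂ) ∉ L.lattice :=
  h.ofReal_notMem_lattice (half_pos h.minRealPeriod_pos) (half_lt_self h.minRealPeriod_pos)

/-- `iΩ₀' ∈ Λ`, where `Ω₀'` is the least positive real period of `iΛ`. [folklore] -/
theorem IsReal.I_mul_minRealPeriod_mem (h : L.IsReal) :
    I * ((L.mulLeft I I_ne_zero).minRealPeriod : ℂ) ∈ L.lattice := by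
  have h1 : (((L.mulLeft I I_ne_zero).minRealPeriod : ℝ) : ℂ) ∈ (L.mulLeft I I_ne_zero).lattice :=
    h.mulLeft_I.minRealPeriod_mem_lattice
  rw [mem_mulLeft_lattice, Complex.inv_I] at h1
  have := neg_mem h1
  convert this using 1
  ring

/-- **A real lattice with `g₂³ − 27g₃² > 0` is not rhombic**: `Ω₀/2 + iΩ₀'/2 ∉ Λ` (Lawden §6.16:
`disc > 0` is the rectangular case). Otherwise `℘(iΩ₀'/2) = ℘(−Ω₀/2) = e₁`; the cubic
`f = 4x³ − g₂x − g₃` is negative below `℘(iΩ₀'/2)` and positive above `e₁`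
(`IsReal.cubic_neg_of_lt`, `IsReal.cubic_pos_of_lt`), so `e₁` is its only real root, whereas
`disc f = (g₂ − 3e₁²)(12e₁² − g₂)² > 0` produces the two further real roots `(−e₁ ± √(g₂ − 3e₁²))/2`
(the argument of `IsReal.integral_inv_sqrt_cubic_of_discr_pos_eq`).
[cite: Lawden1989, §6.16 (p. 179)] -/
theorem IsReal.half_add_I_mul_half_notMem_of_discr_pos (h : L.IsReal)
    (hdisc : 0 < L.g₂.re ^ 3 - 27 * L.g₃.re ^ 2) :
    I * (((L.mulLeft I I_ne_zero).minRealPeriod / 2 : ℝ) : ℂ) + ((L.minRealPeriod / 2 : ℝ) : ℂ) ∉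
      L.lattice := by
  set e₁ := L.weierstrassPRe (L.minRealPeriod / 2) with he₁_def
  set A := L.g₂.re with hA
  set B := L.g₃.re with hB
  have he₁ : 4 * e₁ ^ 3 - A * e₁ - B = 0 := h.cubic_weierstrassPRe_half
  have hright : ∀ x, e₁ < x → 0 < 4 * x ^ 3 - A * x - B := fun x hx ↦ h.cubic_pos_of_lt hx
  set L' := L.mulLeft I I_ne_zero with hL'
  set w : ℂ := I * ((L'.minRealPeriod / 2 : ℝ) : ℂ) with hw
  have hPw : (℘[L] w).re = -L'.weierstrassPRe (L'.minRealPeriod / 2) := by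
    rw [hw, weierstrassP_I_mul, Complex.neg_re]
    rfl
  have hleft : ∀ x, x < (℘[L] w).re → 4 * x ^ 3 - A * x - B < 0 := by
    intro x hx
    rw [hPw] at hx
    exact h.cubic_neg_of_lt hx
  intro hcase
  have hPw' : (℘[L] w).re = e₁ := by
    have := L.weierstrassP_sub_coe w ⟨_, hcase⟩
    rw [Subtype.coe_mk, show w - (w + ((L.minRealPeriod / 2 : ℝ) : ℂ)) =
      -((L.minRealPeriod / 2 : ℝ) : ℂ) by ring, weierstrassP_neg] at this
    rw [← this]
    rfl
  have honly : ∀ r, 4 * r ^ 3 - A * r - B = 0 → r = e₁ := by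
    intro r hr
    rcases lt_trichotomy r e₁ with hlt | heq | hgt
    · have := hleft r (by rw [hPw']; exact hlt)
      rw [hr] at this
      exact absurd this (lt_irrefl 0)
    · exact heq
    · have := hright r hgt
      rw [hr] at this
      exact absurd this (lt_irrefl 0)
  have hD : 0 < A - 3 * e₁ ^ 2 := by
    rw [cubic_discr_eq_of_root he₁] at hdisc
    exact pos_of_mul_pos_left hdisc (sq_nonneg _)
  set s := Real.sqrt (A - 3 * e₁ ^ 2) with hs
  have hs2 : s ^ 2 = A - 3 * e₁ ^ 2 := Real.sq_sqrt hD.le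
  have hs0 : 0 < s := Real.sqrt_pos.mpr hD
  have hr₁ : 4 * ((-e₁ + s) / 2) ^ 3 - A * ((-e₁ + s) / 2) - B = 0 := by
    rw [cubic_eq_mul_of_root he₁]
    have : 4 * ((-e₁ + s) / 2) ^ 2 + 4 * e₁ * ((-e₁ + s) / 2) + (4 * e₁ ^ 2 - A) = 0 := by
      linear_combination hs2
    rw [this, mul_zero]
  have hr₂ : 4 * ((-e₁ - s) / 2) ^ 3 - A * ((-e₁ - s) / 2) - B = 0 := by
    rw [cubic_eq_mul_of_root he₁]
    have : 4 * ((-e₁ - s) / 2) ^ 2 + 4 * e₁ * ((-e₁ - s) / 2) + (4 * e₁ ^ 2 - A) = 0 := by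
      linear_combination hs2
    rw [this, mul_zero]
  have h1 := honly _ hr₁
  have h2 := honly _ hr₂
  linarith

/-- **Rectangular real lattices** (Lawden §6.16; Silverman ATAEC V.2; Cremona §2.8, p. 26: for a
rectangular period lattice the least real part of a period is the least positive real period
`Ω₀`): if `Λ` is a real lattice with `g₂³ − 27g₃² > 0` then `re z ∈ ℤΩ₀` for every `z ∈ Λ`.
Proof: `re z = aΩ₀/2`, `im z = bΩ₀'/2` with `a, b ∈ ℤ`; if `a` were odd, subtracting
`⌊a/2⌋Ω₀ + ⌊b/2⌋ iΩ₀' ∈ Λ` would put `Ω₀/2` (if `b` is even) or `Ω₀/2 + iΩ₀'/2` (if `b` is odd) in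
`Λ`, contradicting `IsReal.half_minRealPeriod_notMem` resp.
`IsReal.half_add_I_mul_half_notMem_of_discr_pos`. [cite: Lawden1989, §6.16 (p. 179)] -/
theorem IsReal.exists_re_eq_int_mul_of_discr_pos (h : L.IsReal)
    (hdisc : 0 < L.g₂.re ^ 3 - 27 * L.g₃.re ^ 2) {z : ℂ} (hz : z ∈ L.lattice) :
    ∃ k : ℤ, z.re = k * L.minRealPeriod := by
  obtain ⟨a, ha⟩ := h.exists_re_eq_int_mul_half hz
  obtain ⟨b, hb⟩ := h.exists_im_eq_int_mul_half hz
  have hΩ : ∀ j : ℤ, (j : ℂ) * (L.minRealPeriod : ℂ) ∈ L.lattice := fun j ↦ by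
    have := zsmul_mem h.minRealPeriod_mem_lattice j
    rwa [zsmul_eq_mul] at this
  have hΩ' : ∀ j : ℤ, (j : ℂ) * (I * ((L.mulLeft I I_ne_zero).minRealPeriod : ℂ)) ∈ L.lattice :=
    fun j ↦ by
    have := zsmul_mem h.I_mul_minRealPeriod_mem j
    rwa [zsmul_eq_mul] at this
  rcases Int.even_or_odd a with ⟨j, rfl⟩ | ⟨j, rfl⟩
  · exact ⟨j, by rw [ha]; push_cast; ring⟩
  · exfalso
    rcases Int.even_or_odd b with ⟨i, rfl⟩ | ⟨i, rfl⟩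
    · refine h.half_minRealPeriod_notMem ?_
      have key : ((L.minRealPeriod / 2 : ℝ) : ℂ) = z - (j : ℂ) * (L.minRealPeriod : ℂ) -
          (i : ℂ) * (I * ((L.mulLeft I I_ne_zero).minRealPeriod : ℂ)) := by
        rw [← Complex.re_add_im z, ha, hb]
        push_cast
        ring
      rw [key]
      exact sub_mem (sub_mem hz (hΩ j)) (hΩ' i)
    · refine h.half_add_I_mul_half_notMem_of_discr_pos hdisc ?_
      have key : I * ((((L.mulLeft I I_ne_zero).minRealPeriod / 2 : ℝ)) : ℂ) +
          ((L.minRealPeriod / 2 : ℝ) : ℂ) = z - (j : ℂ) * (L.minRealPeriod : ℂ) -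
          (i : ℂ) * (I * ((L.mulLeft I I_ne_zero).minRealPeriod : ℂ)) := by
        rw [← Complex.re_add_im z, ha, hb]
        push_cast
        ring
      rw [key]
      exact sub_mem (sub_mem hz (hΩ j)) (hΩ' i)

end PeriodPair

/-! ### The period relation for a modular parametrisation datum -/

namespace Literature.NumberTheory.EllipticCurves.ModularForms

open CongruenceSubgroup

section PlusPeriod

variable {N : ℕ} (f : CuspForm (Gamma0 N) 2)

/-- If `Ω⁺_f > 0` (so `plusPeriod f` is not the junk value `0`) then `re Λ_f = ℤ · (Ω⁺_f/2)`, by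
the definition of `plusPeriod` (Cremona §2.8, p. 26: "`Ω(f)` is twice the least real part of a period
of `f`"). [cite: CremonaAlgorithms1997, §2.8 (p. 26)] -/
theorem realPeriods_eq_zmultiples_of_plusPeriod_pos (h : 0 < plusPeriod f) :
    realPeriods f = AddSubgroup.zmultiples (plusPeriod f / 2) := by
  classical
  have hex : ∃ Ω : ℝ, 0 < Ω ∧ realPeriods f = AddSubgroup.zmultiples (Ω / 2) := by
    by_contra hex
    simp [plusPeriod, dif_neg hex] at h
  simp only [plusPeriod, dif_pos hex]
  exact hex.choose_spec.2

end PlusPeriod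

namespace ModularParametrizationData

variable {W : WeierstrassCurve ℚ} {N : ℕ} [NeZero N] (D : ModularParametrizationData W N)

/-- `c₄` of the base change to `ℝ` is `c₄(W)` cast to `ℝ`. [folklore] -/
theorem baseChange_real_c₄ : (W.baseChange ℝ).c₄ = (W.c₄ : ℝ) := by
  rw [WeierstrassCurve.baseChange, WeierstrassCurve.map_c₄, eq_ratCast]

/-- `c₆` of the base change to `ℝ` is `c₆(W)` cast to `ℝ`. [folklore] -/
theorem baseChange_real_c₆ : (W.baseChange ℝ).c₆ = (W.c₆ : ℝ) := by
  rw [WeierstrassCurve.baseChange, WeierstrassCurve.map_c₆, eq_ratCast]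

/-- `g₂(Λ_E) = c₄(W)/12` as a real number cast to `ℂ` (from the field `isNeronLattice`). [folklore] -/
theorem neronLattice_g₂ : D.L.g₂ = ((((W.c₄ : ℚ) : ℝ) / 12 : ℝ) : ℂ) := by
  rw [D.isNeronLattice.1, WeierstrassCurve.baseChange, WeierstrassCurve.map_c₄, eq_ratCast]
  push_cast
  ring

/-- `g₃(Λ_E) = c₆(W)/216` as a real number cast to `ℂ` (from the field `isNeronLattice`).
[folklore] -/
theorem neronLattice_g₃ : D.L.g₃ = ((((W.c₆ : ℚ) : ℝ) / 216 : ℝ) : ℂ) := by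
  rw [D.isNeronLattice.2, WeierstrassCurve.baseChange, WeierstrassCurve.map_c₆, eq_ratCast]
  push_cast
  ring

/-- **`Λ_E` is a real lattice**: its invariants `c₄/12`, `c₆/216` are real, so by the uniqueness
half of the Uniformization Theorem (`PeriodPair.uniformization_unique_holds`, Silverman AEC VI.5.1)
it is stable under complex conjugation (Silverman ATAEC V.2). [folklore] -/
theorem isReal_neronLattice : D.L.IsReal :=
  PeriodPair.isReal_of_g₂_g₃_real PeriodPair.uniformization_unique_holds
    (by rw [D.neronLattice_g₂, Complex.ofReal_im]) (by rw [D.neronLattice_g₃, Complex.ofReal_im])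

/-- `disc(Λ_E) = g₂³ − 27g₃² = (c₄³ − c₆²)/1728 = Δ(W)` (Silverman AEC III.1). [folklore] -/
theorem discr_neronLattice : D.L.g₂.re ^ 3 - 27 * D.L.g₃.re ^ 2 = (W.baseChange ℝ).Δ := by
  rw [D.neronLattice_g₂, D.neronLattice_g₃, Complex.ofReal_re, Complex.ofReal_re, ← baseChange_real_c₄,
    ← baseChange_real_c₆,
    show ((W.baseChange ℝ).c₄ / 12) ^ 3 - 27 * ((W.baseChange ℝ).c₆ / 216) ^ 2 =
      ((W.baseChange ℝ).c₄ ^ 3 - (W.baseChange ℝ).c₆ ^ 2) / 1728 by ring,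
    ← (W.baseChange ℝ).c_relation]
  ring

/-- **`Ω(W) = #π₀(E(ℝ)) · Ω₀(Λ_E)`**: the real period of the model (item G06,
`W.realPeriodRat = 2∫_{ψ>0} dx/√ψ`) is the number of real components times the least positive real
period of the Néron lattice `Λ_E = D.L.lattice` (Silverman AEC C.16; Cremona §2.8, p. 26, §3.7), by
`WeierstrassCurve.exists_periodPair_realPeriod_eq_holds` and uniqueness of the lattice with given
invariants. [cite: CremonaAlgorithms1997, §2.8 (p. 26)] -/
theorem realPeriodRat_eq_numRealComponents_mul [W.IsElliptic] :
    W.realPeriodRat = (W.baseChange ℝ).numRealComponents * D.L.minRealPeriod := by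
  haveI : (W.baseChange ℝ).IsElliptic := by
    rw [WeierstrassCurve.baseChange]; infer_instance
  obtain ⟨L', h₂', h₃', hΩ⟩ := (W.baseChange ℝ).exists_periodPair_realPeriod_eq_holds
  have hlat : D.L.lattice = L'.lattice :=
    PeriodPair.uniformization_unique_holds _ _
      (by rw [h₂', D.neronLattice_g₂, baseChange_real_c₄])
      (by rw [h₃', D.neronLattice_g₃, baseChange_real_c₆])
  rw [WeierstrassCurve.realPeriodRat_def, hΩ, PeriodPair.minRealPeriod_def, hlat]

/-- **`re Λ_E ⊆ ℤ · Ω(W)/2`** (Cremona §2.8, p. 26; §2.10): if `Δ > 0` then `Ω(W) = 2Ω₀` and the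
lattice is rectangular, `re Λ_E ⊆ ℤΩ₀`; if `Δ < 0` then `Ω(W) = Ω₀` and `re Λ_E ⊆ ℤ(Ω₀/2)` always.
[cite: CremonaAlgorithms1997, §2.8 (p. 26)] -/
theorem exists_re_eq_int_mul_realPeriodRat_div_two [W.IsElliptic] {z : ℂ} (hz : z ∈ D.L.lattice) :
    ∃ k : ℤ, z.re = k * (W.realPeriodRat / 2) := by
  rw [D.realPeriodRat_eq_numRealComponents_mul]
  by_cases hΔ : 0 < (W.baseChange ℝ).Δ
  · rw [(W.baseChange ℝ).numRealComponents_of_Δ_pos hΔ]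
    have hdisc : 0 < D.L.g₂.re ^ 3 - 27 * D.L.g₃.re ^ 2 := by rwa [D.discr_neronLattice]
    obtain ⟨k, hk⟩ := D.isReal_neronLattice.exists_re_eq_int_mul_of_discr_pos hdisc hz
    exact ⟨k, by rw [hk]; push_cast; ring⟩
  · rw [(W.baseChange ℝ).numRealComponents_of_Δ_nonpos (not_lt.mp hΔ)]
    obtain ⟨k, hk⟩ := D.isReal_neronLattice.exists_re_eq_int_mul_half hz
    exact ⟨k, by rw [hk]; push_cast; ring⟩

/-- **Discharge of `realPeriodRat_dvd`** (the period relation `m · Ω(W) = |c| · Ω⁺_f`, `0 < m`;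
Edixhoven 1991, §1: `φ^* ω_E = c · 2πi f dτ`, i.e. `c Λ_f ⊆ Λ_E`; Cremona §2.8, p. 26 and §2.10 for
the normalisations of `Ω(f) = Ω⁺_f` and `Ω(E)`). With `Ω⁺_f > 0`
(`IsNewform0.plusPeriod_pos_holds` for the rational newform `D.f`) pick `z ∈ Λ_f` with
`re z = Ω⁺_f/2`; then `c z ∈ Λ_E`, so `c Ω⁺_f/2 = k Ω(W)/2` with `k ∈ ℤ`
(`exists_re_eq_int_mul_realPeriodRat_div_two`), and `k ≠ 0` because `c ≠ 0`
(`maninConstant_ne_zero_holds`); `m = |k|`. [cite: EdixhovenManin1991, §1] -/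
theorem realPeriodRat_dvd_holds : D.realPeriodRat_dvd := by
  intro hE
  haveI : (W.baseChange ℝ).IsElliptic := by
    rw [WeierstrassCurve.baseChange]; infer_instance
  have hpos : 0 < plusPeriod D.f :=
    IsNewform0.plusPeriod_pos_holds D.isNewformOf.1 D.isNewformOf.coeffField_eq_bot
  have hre : realPeriods D.f = AddSubgroup.zmultiples (plusPeriod D.f / 2) :=
    realPeriods_eq_zmultiples_of_plusPeriod_pos D.f hpos
  have hmem : plusPeriod D.f / 2 ∈ realPeriods D.f := by
    rw [hre]
    exact AddSubgroup.mem_zmultiples _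
  rw [realPeriods, AddSubgroup.mem_map] at hmem
  obtain ⟨z, hz, hzre⟩ := hmem
  have hzre' : z.re = plusPeriod D.f / 2 := by simpa using hzre
  have hcz : (D.c : ℂ) * z ∈ D.L.lattice := D.smul_periodLattice_le z hz
  obtain ⟨k, hk⟩ := D.exists_re_eq_int_mul_realPeriodRat_div_two hcz
  have hmul : ((D.c : ℂ) * z).re = (D.c : ℝ) * z.re := by
    rw [Complex.mul_re, Complex.intCast_re, Complex.intCast_im, zero_mul, sub_zero]
  rw [hmul, hzre'] at hk
  have hk' : (D.c : ℝ) * plusPeriod D.f = k * W.realPeriodRat := by linarith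
  have hc : (D.c : ℝ) ≠ 0 := Int.cast_ne_zero.mpr D.maninConstant_ne_zero_holds
  have hk0 : k ≠ 0 := by
    rintro rfl
    rw [Int.cast_zero, zero_mul] at hk'
    exact mul_ne_zero hc hpos.ne' hk'
  have hΩ : 0 ≤ W.realPeriodRat := by
    rw [WeierstrassCurve.realPeriodRat_def]
    exact (W.baseChange ℝ).realPeriod_pos'.le
  refine ⟨k.natAbs, Int.natAbs_pos.mpr hk0, ?_⟩
  have hcast : ((k.natAbs : ℕ) : ℝ) = |(k : ℝ)| := by
    rw [Nat.cast_natAbs, Int.cast_abs]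
  change ((k.natAbs : ℕ) : ℝ) * W.realPeriodRat = |(D.c : ℝ)| * plusPeriod D.f
  rw [hcast, ← abs_of_nonneg hΩ, ← abs_mul, ← hk', abs_mul, abs_of_pos hpos]

end ModularParametrizationData

end Literature.NumberTheory.EllipticCurves.ModularForms

end
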